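import Summits.AtomisticToContinuum.HydrodynamicLimit.Theorems.LambertianContactSwapSwapGapLiouvilleInvarianceLambda
import Summits.AtomisticToContinuum.HydrodynamicLimit.Theorems.LambertianContactSwapLambertianEulerEntropyBudget
import Summits.AtomisticToContinuum.HydrodynamicLimit.Theorems.TwoClocksClampedEntropyClockKlDivLawAtLocalGibbsNeTop
import Literature.MathematicalPhysics.KineticTheory.LambertianRedrawNondegenerate
import HarnessLib

/-!
# The relative-entropy LEDGER of the Lambertian gas (crux `LambertianEuler`, stmt-AtomisticToContinuum-11854, line `Sketch`, stub `stub_klLedgerLambda`)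

Worker file (`--supports stmt-AtomisticToContinuum-11854`) closing the registered stub
`stub_klLedgerLambda` of the skeleton `Cruxes/LambertianEuler/Lines/Sketch.lean`: the first line of
Yau's relative-entropy method for the LAMBERTIAN hard-sphere gas `Λ` on `𝕋³`
(`lambertFlow G ε ξs z t`: free flight + hard-sphere collisions at which the outgoing relative
velocity of the colliding pair is redrawn with the cosine law from the i.i.d. Gaussian noise
`ξs ~ γ^ℕ = lambertNoise (Fin 3)`).

**Statement.** Let `0 < σ < 1/2`, `L = liouville (Torus.geometry (Fin 3)) (N + 1) (hsDiameter σ N)`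
the Liouville measure of the hard-sphere domain, `ψ₀ = localGibbsLaw σ b₀ w₀ ϑ₀ N Φ` and
`ψ = localGibbsLaw σ b w ϑ N Φ` two local Gibbs references with continuous positive profiles and
canonical densities `ρ_{ψ₀}`, `ρ_ψ` w.r.t. `L`, and `P ≪ L` an initial probability law with
integrable kinetic energy and `KL(P ‖ ψ₀) < ∞`. Then for every `t ≥ 0`, writing
`Λ_t (z, ξs) = lambertFlow … ξs z t` and `P ⊗ γ^ℕ` for the annealed initial law,

* `KL((P ⊗ γ^ℕ) ∘ Λ_t⁻¹ ‖ ψ) < ∞`, and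
* `KL((P ⊗ γ^ℕ) ∘ Λ_t⁻¹ ‖ ψ) - KL(P ‖ ψ₀) ≤ E_{P ⊗ γ^ℕ}[log ρ_{ψ₀}(z) - log ρ_ψ(Λ_t(z, ξs))]`.

For the deterministic flow this is the transport IDENTITY `toReal_klDiv_lawAt_localGibbsLaw_sub`
(`Theorems/OneFlightGossipEngineAssemblyEntropyProduction.lean`); for `Λ` the noise is integrated
out and the identity becomes an INEQUALITY by data processing.

**Proof route.**
1. `P = f dL` with `f = dP/dL` (`Measure.withDensity_rnDeriv_eq`), so `P ⊗ γ = (f ∘ fst) d(L ⊗ γ)`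
   (`prod_withDensity_left`).
2. Reference on the big space `ν := (ρ_ψ ∘ Λ_t) d(L ⊗ γ)`. By the `Λ`-LIOUVILLE THEOREM
   `(L ⊗ γ) ∘ Λ_t⁻¹ = L` (`…SwapGapLiouvilleInvarianceLambda.stub_liouvilleInvarianceLambda`, at
   `ε = hsDiameter σ N ∈ (0, 1/2)`), `ν ∘ Λ_t⁻¹ = ρ_ψ dL = ψ` (`map_withDensity_comp_eq`), in particular
   `ν` is a probability measure.
3. DATA PROCESSING through the deterministic kernel `Λ_t` on the standard Borel space
   `Config × (ℕ → ℝ³)` (`Literature.Probability.Entropy.klDiv_comp_le`):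
   `KL((P ⊗ γ) ∘ Λ_t⁻¹ ‖ ψ) = KL((P ⊗ γ) ∘ Λ_t⁻¹ ‖ ν ∘ Λ_t⁻¹) ≤ KL(P ⊗ γ ‖ ν)`.
4. REAL FORM: all laws have unit mass, so `KL(P ⊗ γ ‖ ν) = ∫ llr = ∫ (log f(z) - log ρ_ψ(Λ_t)) d(P ⊗ γ)`
   and `KL(P ‖ ψ₀) = ∫ (log f - log ρ_{ψ₀}) dP` (`llr_withDensity_ae_eq`, `toReal_klDiv_of_measure_eq`);
   subtracting, the `f`-terms cancel (`integral_fun_fst`). This is the abstract `klDiv_map_prod_ledger`.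
5. INTEGRABILITY of `log ρ_{ψ₀}(z) - log ρ_ψ(Λ_t(z, ξs))` under `P ⊗ γ`: a.s. both `z` and
   `Λ_t(z, ξs)` lie in the hard-sphere domain (`L` lives on it and `Λ_t` transports `L ⊗ γ` to `L`),
   where `log ρ` is a ONE-BODY sum plus a c-number (`EntropyClockDock.log_canonicalDensity_localGibbsProfile`)
   dominated by `C (N + 1) + C Σ_i |v_i|²` (`QuenchedCellClock.abs_oneBody_le`, `abs_sum_oneBody_le`) —
   at time `t` through the PATHWISE energy monotonicity `configEnergy_lambertFlow_le` of `Λ` — and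
   `Σ_i |v_i|²` is `P`-integrable by hypothesis.

References: H.-T. Yau, *Relative entropy and hydrodynamics of Ginzburg–Landau models*, Lett. Math.
Phys. 22 (1991), §2; S. Olla, S. R. S. Varadhan, H.-T. Yau, *Hydrodynamical limit for a Hamiltonian
system with weak noise*, Comm. Math. Phys. 155 (1993), §3 (entropy ledger by data processing for
the noisy dynamics). prover-line-stmt-AtomisticToContinuum-11854-c2-0 (lead c2), stub worker.
-/

noncomputable section

namespace Summit.AtomisticToContinuum.HydrodynamicLimit.Theorems.LambertianContactSwapLambertianEulerKlLedger

open scoped BigOperators Topology ENNReal InnerProductSpace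
open MeasureTheory ProbabilityTheory Filter Set InformationTheory
open Literature.MathematicalPhysics.KineticTheory
open Literature.Analysis.FluidPDE Literature.Analysis.FluidPDE.Alexander

/-! ### §1 The abstract ledger: data processing through an independent randomisation -/

section Abstract

variable {α Ω : Type*} [MeasurableSpace α] [MeasurableSpace Ω]

/-- **Push-forward of a pulled-back density.** If `T` transports `μ` to `L`, then it transports
`(g ∘ T) dμ` to `g dL`. [folklore] -/
theorem map_withDensity_comp_eq {μ : Measure (α × Ω)} {L : Measure α} {T : α × Ω → α}
    (hT : Measurable T) (hinv : μ.map T = L) {g : α → ℝ≥0∞} (hg : Measurable g) :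
    (μ.withDensity fun p => g (T p)).map T = L.withDensity g := by
  ext s hs
  rw [Measure.map_apply hT hs, withDensity_apply _ (hT hs), withDensity_apply _ hs,
    ← setLIntegral_map hs hg hT, hinv]

/-- **The abstract relative-entropy ledger through an independent randomisation.** Let `L` be a
σ-finite reference on a standard Borel space `α`, `γ` a probability law of an independent noise on a
standard Borel space `Ω`, and `T : α × Ω → α` a measurable map with `(L ⊗ γ) ∘ T⁻¹ = L`. Let
`ψ₀ = g₀ dL`, `ψ = g dL` be two probability references with measurable, `L`-a.e. positive, finite
densities, and `P ≪ L` a probability law with `KL(P ‖ ψ₀) < ∞` such that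
`log g₀(x) - log g(T(x, ω))` is `P ⊗ γ`-integrable. Then `KL((P ⊗ γ) ∘ T⁻¹ ‖ ψ) < ∞` and
`KL((P ⊗ γ) ∘ T⁻¹ ‖ ψ) - KL(P ‖ ψ₀) ≤ ∫ (log g₀(x) - log g(T(x, ω))) d(P ⊗ γ)`: data processing
(`klDiv_comp_le`) for the deterministic kernel `T` against the reference `(g ∘ T) d(L ⊗ γ)`, whose
push-forward is `ψ`, followed by the cancellation of the `dP/dL`-terms. [cite: OllaVaradhanYau1993, §3] -/
theorem klDiv_map_prod_ledger [StandardBorelSpace α] [Nonempty α] [StandardBorelSpace Ω] [Nonempty Ω]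
    (L : Measure α) [SigmaFinite L] (γ : Measure Ω) [IsProbabilityMeasure γ] {T : α × Ω → α}
    (hT : Measurable T) (hinv : (L.prod γ).map T = L) (P : Measure α) [IsProbabilityMeasure P]
    (hPL : P ≪ L) {g₀ g : α → ℝ≥0∞} (hg₀ : Measurable g₀) (hg : Measurable g)
    (hg₀0 : ∀ᵐ x ∂L, g₀ x ≠ 0) (hg₀top : ∀ x, g₀ x ≠ ∞) (hg0 : ∀ᵐ x ∂L, g x ≠ 0)
    (hgtop : ∀ x, g x ≠ ∞) (ψ₀ ψ : Measure α) [IsProbabilityMeasure ψ₀] [IsProbabilityMeasure ψ]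
    (hψ₀ : ψ₀ = L.withDensity g₀) (hψ : ψ = L.withDensity g) (hkl : klDiv P ψ₀ ≠ ⊤)
    (hint : Integrable (fun p : α × Ω => Real.log (g₀ p.1).toReal - Real.log (g (T p)).toReal)
      (P.prod γ)) :
    klDiv ((P.prod γ).map T) ψ ≠ ⊤ ∧
      (klDiv ((P.prod γ).map T) ψ).toReal - (klDiv P ψ₀).toReal ≤
        ∫ p, (Real.log (g₀ p.1).toReal - Real.log (g (T p)).toReal) ∂(P.prod γ) := by
  subst hψ₀ hψ
  -- step 1: `P = f dL`, `P ⊗ γ = (f ∘ fst) d(L ⊗ γ)` with `f = dP/dL` a.e. finite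
  have hf : Measurable (P.rnDeriv L) := Measure.measurable_rnDeriv P L
  have hPf : L.withDensity (P.rnDeriv L) = P := Measure.withDensity_rnDeriv_eq P L hPL
  have hftop : ∀ᵐ x ∂L, P.rnDeriv L x ≠ ∞ := Measure.rnDeriv_ne_top P L
  have hf1 : Measurable fun p : α × Ω => P.rnDeriv L p.1 := hf.comp measurable_fst
  have hf1top : ∀ᵐ p ∂(L.prod γ), P.rnDeriv L p.1 ≠ ∞ :=
    Measure.quasiMeasurePreserving_fst.ae hftop
  have hμ : P.prod γ = (L.prod γ).withDensity fun p => P.rnDeriv L p.1 := by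
    rw [← prod_withDensity_left hf, hPf]
  -- step 2: the reference `ν = (g ∘ T) d(L ⊗ γ)` on the big space; its push-forward is `g dL`
  obtain ⟨ν, hν⟩ : ∃ ν : Measure (α × Ω), ν = (L.prod γ).withDensity fun p => g (T p) := ⟨_, rfl⟩
  have hgT : Measurable fun p : α × Ω => g (T p) := hg.comp hT
  have hq : Measure.QuasiMeasurePreserving T (L.prod γ) L :=
    ⟨hT, Measure.absolutelyContinuous_of_le hinv.le⟩
  have hgT0 : ∀ᵐ p ∂(L.prod γ), g (T p) ≠ 0 := hq.ae hg0
  have hνmap : ν.map T = L.withDensity g := by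
    rw [hν]
    exact map_withDensity_comp_eq hT hinv hg
  haveI : IsProbabilityMeasure ν := by
    refine ⟨?_⟩
    have h1 : ν.map T univ = 1 := by rw [hνmap]; exact measure_univ
    rwa [Measure.map_apply hT MeasurableSet.univ, Set.preimage_univ] at h1
  -- step 3: data processing through the deterministic kernel `T`
  have hdpi : klDiv ((P.prod γ).map T) (L.withDensity g) ≤ klDiv (P.prod γ) ν := by
    have h := Literature.Probability.Entropy.klDiv_comp_le (P.prod γ) ν (Kernel.deterministic T hT)
    rwa [Measure.deterministic_comp_eq_map, Measure.deterministic_comp_eq_map, hνmap] at h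
  -- step 4: log-likelihood ratios, integrability, finiteness
  obtain ⟨hacP, hintP⟩ := klDiv_ne_top_iff.1 hkl
  have hllrP : llr P (L.withDensity g₀) =ᵐ[P]
      fun x => Real.log (P.rnDeriv L x).toReal - Real.log (g₀ x).toReal := by
    have h := llr_withDensity_ae_eq L hf hg₀ hftop hg₀0 (Eventually.of_forall hg₀top)
    rwa [hPf] at h
  have hllrμ : llr (P.prod γ) ν =ᵐ[P.prod γ]
      fun p => Real.log (P.rnDeriv L p.1).toReal - Real.log (g (T p)).toReal := by
    have h := llr_withDensity_ae_eq (L.prod γ) hf1 hgT hf1top hgT0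
      (Eventually.of_forall fun p => hgtop (T p))
    rwa [← hμ, ← hν] at h
  have hintP' : Integrable (fun x => Real.log (P.rnDeriv L x).toReal - Real.log (g₀ x).toReal) P :=
    hintP.congr hllrP
  have hint1 : Integrable (fun p : α × Ω =>
      Real.log (P.rnDeriv L p.1).toReal - Real.log (g₀ p.1).toReal) (P.prod γ) :=
    hintP'.comp_fst γ
  have hintμ : Integrable (fun p : α × Ω =>
      Real.log (P.rnDeriv L p.1).toReal - Real.log (g (T p)).toReal) (P.prod γ) := by
    refine (hint1.add hint).congr (Eventually.of_forall fun p => ?_)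
    simp only [Pi.add_apply]
    ring
  have hacμ : P.prod γ ≪ ν := by
    rw [hμ, hν]
    exact (withDensity_absolutelyContinuous _ _).trans
      (withDensity_absolutelyContinuous' hgT.aemeasurable hgT0)
  have hklμ : klDiv (P.prod γ) ν ≠ ⊤ := klDiv_ne_top hacμ (hintμ.congr hllrμ.symm)
  -- step 5: real forms (all laws have unit mass) and cancellation of the `dP/dL`-terms
  have hrealμ : (klDiv (P.prod γ) ν).toReal =
      ∫ p, (Real.log (P.rnDeriv L p.1).toReal - Real.log (g (T p)).toReal) ∂(P.prod γ) := by
    rw [toReal_klDiv_of_measure_eq hacμ (by rw [measure_univ, measure_univ]),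
      integral_congr_ae hllrμ]
  have hrealP : (klDiv P (L.withDensity g₀)).toReal =
      ∫ x, (Real.log (P.rnDeriv L x).toReal - Real.log (g₀ x).toReal) ∂P := by
    rw [toReal_klDiv_of_measure_eq hacP (by rw [measure_univ, measure_univ]),
      integral_congr_ae hllrP]
  have hfst : ∫ p, (Real.log (P.rnDeriv L p.1).toReal - Real.log (g₀ p.1).toReal) ∂(P.prod γ) =
      ∫ x, (Real.log (P.rnDeriv L x).toReal - Real.log (g₀ x).toReal) ∂P := by
    rw [integral_fun_fst (fun x => Real.log (P.rnDeriv L x).toReal - Real.log (g₀ x).toReal),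
      probReal_univ, one_smul]
  refine ⟨ne_top_of_le_ne_top hklμ hdpi, ?_⟩
  calc (klDiv ((P.prod γ).map T) (L.withDensity g)).toReal - (klDiv P (L.withDensity g₀)).toReal
      ≤ (klDiv (P.prod γ) ν).toReal - (klDiv P (L.withDensity g₀)).toReal :=
        sub_le_sub_right (ENNReal.toReal_mono hklμ hdpi) _
    _ = ∫ p, ((Real.log (P.rnDeriv L p.1).toReal - Real.log (g (T p)).toReal) -
          (Real.log (P.rnDeriv L p.1).toReal - Real.log (g₀ p.1).toReal)) ∂(P.prod γ) := by
        rw [integral_sub hintμ hint1, hrealμ, hrealP, hfst]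
    _ = ∫ p, (Real.log (g₀ p.1).toReal - Real.log (g (T p)).toReal) ∂(P.prod γ) :=
        integral_congr_ae (Eventually.of_forall fun p => by ring)

end Abstract

/-! ### §2 One-body sums are integrable against an integrable kinetic energy -/

/-- **Domination of a one-body sum.** For continuous `b, ϑ > 0`, `w` on the torus and a measurable
`Config`-valued map `F` whose kinetic energy `Σ_i |v_i(F p)|²` is dominated by an integrable `E`, the
one-body sum `Σ_i g((F p)_i)`, `g(x, v) = log b(x) − (3/2) log(2πϑ(x)) − |v − w(x)|²/(2ϑ(x))`, is
integrable (`|Σ_i g| ≤ C n + C Σ_i |v_i|²`, `QuenchedCellClock.abs_sum_oneBody_le`). [folklore] -/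
theorem integrable_sum_oneBody_comp {β : Type*} [MeasurableSpace β] (μ : Measure β) [IsFiniteMeasure μ]
    {b ϑ : T3 → ℝ} {w : T3 → V3} (hb : Continuous b) (hϑ : Continuous ϑ) (hw : Continuous w)
    (hb0 : ∀ x, 0 < b x) (hϑ0 : ∀ x, 0 < ϑ x) {n : ℕ} {F : β → Config n (Fin 3) T3}
    (hF : Measurable F) {E : β → ℝ} (hE : Integrable E μ) (hle : ∀ p, ∑ i, ‖(F p i).2‖ ^ 2 ≤ E p) :
    Integrable (fun p => ∑ i, (Real.log (b (F p i).1) - 3 / 2 * Real.log (2 * Real.pi * ϑ (F p i).1) -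
      ‖(F p i).2 - w (F p i).1‖ ^ 2 / (2 * ϑ (F p i).1))) μ := by
  obtain ⟨C, hC0, hC⟩ := QuenchedCellClock.abs_oneBody_le hb hϑ hw hb0 hϑ0
  have hdom : Integrable (fun p => C * n + C * E p) μ := (integrable_const _).add (hE.const_mul C)
  refine hdom.mono' ((QuenchedCellClock.measurable_sum_oneBody hb hϑ hw n).comp hF).aestronglyMeasurable
    (Eventually.of_forall fun p => ?_)
  rw [Real.norm_eq_abs]
  exact (QuenchedCellClock.abs_sum_oneBody_le hC (F p)).trans
    (add_le_add le_rfl (mul_le_mul_of_nonneg_left (hle p) hC0))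

/-! ### §3 The stub -/

/-- **Registered stub `stub_klLedgerLambda` of line `Sketch` — the relative-entropy LEDGER of the
Lambertian gas.** For `0 < σ < 1/2`, two local Gibbs references `ψ₀ = localGibbsLaw σ b₀ w₀ ϑ₀ N Φ`,
`ψ = localGibbsLaw σ b w ϑ N Φ` with continuous positive profiles, an initial probability law
`P ≪ liouville` on the `(N + 1)`-sphere phase space over `𝕋³` with integrable kinetic energy and
`KL(P ‖ ψ₀) < ∞`, and every `t ≥ 0`: the annealed law `(P ⊗ γ^ℕ) ∘ Λ_t⁻¹` of the Lambertian flow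
started from `P` has `KL((P ⊗ γ^ℕ) ∘ Λ_t⁻¹ ‖ ψ) < ∞` and
`KL((P ⊗ γ^ℕ) ∘ Λ_t⁻¹ ‖ ψ) - KL(P ‖ ψ₀) ≤ E_{P ⊗ γ^ℕ}[log ρ_{ψ₀}(z) - log ρ_ψ(Λ_t(z, ξs))]`
(`ρ_•` the canonical densities). Data processing through the noise against the pulled-back reference
(`klDiv_map_prod_ledger`) using the `Λ`-Liouville theorem, plus integrability of the one-body
log-densities by pathwise energy monotonicity of `Λ`. [cite: OllaVaradhanYau1993, §3] -/
theorem stub_klLedgerLambda :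
    ∀ {σ : ℝ}, 0 < σ → σ < 2⁻¹ → ∀ {b₀ ϑ₀ b ϑ : T3 → ℝ} {w₀ w : T3 → V3},
      Continuous b₀ → Continuous ϑ₀ → Continuous w₀ → (∀ x, 0 < b₀ x) → (∀ x, 0 < ϑ₀ x) →
      Continuous b → Continuous ϑ → Continuous w → (∀ x, 0 < b x) → (∀ x, 0 < ϑ x) →
      ∀ (N : ℕ) (Φ : HardSphereFlow (Torus.geometry (Fin 3)) (hsDiameter σ N) (N + 1))
        (P : Measure (Config (N + 1) (Fin 3) T3)) [IsProbabilityMeasure P],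
        P ≪ liouville (Torus.geometry (Fin 3)) (N + 1) (hsDiameter σ N) →
        Integrable (fun z : Config (N + 1) (Fin 3) T3 => ∑ i, ‖(z i).2‖ ^ 2) P →
        klDiv P (localGibbsLaw σ b₀ w₀ ϑ₀ N Φ) ≠ ⊤ →
        ∀ t : ℝ, 0 ≤ t →
          klDiv ((P.prod (lambertNoise (Fin 3))).map
              (fun p => lambertFlow (Torus.geometry (Fin 3)) (hsDiameter σ N) p.2 p.1 t))
            (localGibbsLaw σ b w ϑ N Φ) ≠ ⊤ ∧
          (klDiv ((P.prod (lambertNoise (Fin 3))).map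
              (fun p => lambertFlow (Torus.geometry (Fin 3)) (hsDiameter σ N) p.2 p.1 t))
            (localGibbsLaw σ b w ϑ N Φ)).toReal - (klDiv P (localGibbsLaw σ b₀ w₀ ϑ₀ N Φ)).toReal ≤
          ∫ p, (Real.log (canonicalDensity (Torus.geometry (Fin 3)) (hsDiameter σ N) (N + 1)
                (localGibbsProfile b₀ w₀ ϑ₀) p.1) -
              Real.log (canonicalDensity (Torus.geometry (Fin 3)) (hsDiameter σ N) (N + 1)
                (localGibbsProfile b w ϑ)
                (lambertFlow (Torus.geometry (Fin 3)) (hsDiameter σ N) p.2 p.1 t)))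
            ∂(P.prod (lambertNoise (Fin 3))) := by
  intro σ hσ hσ' b₀ ϑ₀ b ϑ w₀ w hb₀ hϑ₀ hw₀ hb₀0 hϑ₀0 hb hϑ hw hb0 hϑ0 N Φ P _ hPL hE hkl t ht
  have hσ2 : σ ≤ 1 / 2 := by rw [one_div]; exact hσ'.le
  have hε : 0 < hsDiameter σ N := hsDiameter_pos hσ N
  have hε' : hsDiameter σ N < 2⁻¹ := (hsDiameter_le hσ.le N).trans_lt hσ'
  -- σ-finiteness of the Liouville measure (instance path made explicit) and standard Borel phase space
  haveI hXE : SigmaFinite (volume : Measure (T3 × V3)) := inferInstance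
  haveI hC : SigmaFinite (volume : Measure (Config (N + 1) (Fin 3) T3)) := inferInstance
  haveI hL : SigmaFinite (liouville (Torus.geometry (Fin 3)) (N + 1) (hsDiameter σ N)) := by
    rw [liouville_eq]; infer_instance
  haveI : StandardBorelSpace (Config (N + 1) (Fin 3) T3) :=
    LambertianContactSwapLambertianEulerEntropyBudget.standardBorelSpace_config (N + 1)
  haveI i₁ : IsProbabilityMeasure (localGibbsLaw σ b₀ w₀ ϑ₀ N Φ) :=
    isProbabilityMeasure_localGibbsLaw hb₀ hϑ₀ hw₀ hb₀0 hϑ₀0 hσ2 N Φ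
  haveI i₂ : IsProbabilityMeasure (localGibbsLaw σ b w ϑ N Φ) :=
    isProbabilityMeasure_localGibbsLaw hb hϑ hw hb0 hϑ0 hσ2 N Φ
  -- the Lambertian flow at time `t`: jointly measurable, transports `L ⊗ γ` to `L`
  have hΛ := measurable_lambertFlow_hsDiameter hσ.le hσ' N t
  have hinv := LambertianContactSwapSwapGapLiouvilleInvarianceLambda.stub_liouvilleInvarianceLambda
    (hsDiameter σ N) hε hε' (N + 1) t ht
  have hq : Measure.QuasiMeasurePreserving
      (fun p : Config (N + 1) (Fin 3) T3 × (ℕ → V3) =>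
        lambertFlow (Torus.geometry (Fin 3)) (hsDiameter σ N) p.2 p.1 t)
      ((liouville (Torus.geometry (Fin 3)) (N + 1) (hsDiameter σ N)).prod (lambertNoise (Fin 3)))
      (liouville (Torus.geometry (Fin 3)) (N + 1) (hsDiameter σ N)) :=
    ⟨hΛ, Measure.absolutelyContinuous_of_le hinv.le⟩
  -- the densities: measurable, `toReal ∘ ofReal = id`
  have hm : ∀ {a θ : T3 → ℝ} {u : T3 → V3}, Continuous a → Continuous θ → Continuous u →
      Measurable fun z => ENNReal.ofReal (canonicalDensity (Torus.geometry (Fin 3)) (hsDiameter σ N)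
        (N + 1) (localGibbsProfile a u θ) z) := fun ha hθ hu =>
    (measurable_canonicalDensity _ _ (measurable_localGibbsProfile ha hθ hu)).ennreal_ofReal
  have hto : ∀ {a θ : T3 → ℝ} {u : T3 → V3}, (∀ x, 0 < a x) → (∀ x, 0 < θ x) →
      ∀ z : Config (N + 1) (Fin 3) T3, (ENNReal.ofReal (canonicalDensity (Torus.geometry (Fin 3))
        (hsDiameter σ N) (N + 1) (localGibbsProfile a u θ) z)).toReal =
        canonicalDensity (Torus.geometry (Fin 3)) (hsDiameter σ N) (N + 1) (localGibbsProfile a u θ) z :=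
    fun ha0 hθ0 z => ENNReal.toReal_ofReal (canonicalDensity_localGibbsProfile_nonneg
      (fun x => (ha0 x).le) (fun x => (hθ0 x).le) _ _ _)
  -- a.s. under `P ⊗ γ`, both `z` and `Λ_t (z, ξs)` lie in the hard-sphere domain
  have hDL : ∀ᵐ z ∂liouville (Torus.geometry (Fin 3)) (N + 1) (hsDiameter σ N),
      z ∈ hardSphereDomain (Torus.geometry (Fin 3)) (N + 1) (hsDiameter σ N) := by
    rw [liouville_eq]
    exact ae_restrict_mem (measurableSet_hardSphereDomain _ Torus.measurable_geometry_sepVec _ _)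
  have hac : P.prod (lambertNoise (Fin 3)) ≪
      (liouville (Torus.geometry (Fin 3)) (N + 1) (hsDiameter σ N)).prod (lambertNoise (Fin 3)) :=
    hPL.prod Measure.AbsolutelyContinuous.rfl
  have hD : ∀ᵐ p ∂(P.prod (lambertNoise (Fin 3))),
      p.1 ∈ hardSphereDomain (Torus.geometry (Fin 3)) (N + 1) (hsDiameter σ N) ∧
      lambertFlow (Torus.geometry (Fin 3)) (hsDiameter σ N) p.2 p.1 t ∈
        hardSphereDomain (Torus.geometry (Fin 3)) (N + 1) (hsDiameter σ N) :=
    hac.ae_le ((Measure.quasiMeasurePreserving_fst.ae hDL).and (hq.ae hDL))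
  -- integrability of the two one-body sums (pathwise energy monotonicity at time `t`)
  have hE1 : Integrable (fun p : Config (N + 1) (Fin 3) T3 × (ℕ → V3) => ∑ i, ‖(p.1 i).2‖ ^ 2)
      (P.prod (lambertNoise (Fin 3))) := hE.comp_fst _
  have hS₀ := integrable_sum_oneBody_comp (P.prod (lambertNoise (Fin 3))) hb₀ hϑ₀ hw₀ hb₀0 hϑ₀0
    measurable_fst hE1 (fun p => le_rfl)
  have hS := integrable_sum_oneBody_comp (P.prod (lambertNoise (Fin 3))) hb hϑ hw hb0 hϑ0 hΛ hE1
    (fun p => by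
      have h := configEnergy_lambertFlow_le (G := Torus.geometry (Fin 3)) (ε := hsDiameter σ N) p.2 p.1 t
      simp only [configEnergy] at h
      linarith)
  -- the explicit log-ratio is integrable
  have hI₀ : Integrable (fun p : Config (N + 1) (Fin 3) T3 × (ℕ → V3) =>
      Real.log (canonicalDensity (Torus.geometry (Fin 3)) (hsDiameter σ N) (N + 1)
        (localGibbsProfile b₀ w₀ ϑ₀) p.1)) (P.prod (lambertNoise (Fin 3))) := by
    refine ((integrable_const (-Real.log (posPartition b₀ (hsDiameter σ N) (N + 1)))).add hS₀).congr ?_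
    filter_upwards [hD] with p hp
    rw [Pi.add_apply]
    exact (EntropyClockDock.log_canonicalDensity_localGibbsProfile hb₀ hϑ₀ hw₀ hb₀0 hϑ₀0 hσ2 N hp.1).symm
  have hI : Integrable (fun p : Config (N + 1) (Fin 3) T3 × (ℕ → V3) =>
      Real.log (canonicalDensity (Torus.geometry (Fin 3)) (hsDiameter σ N) (N + 1)
        (localGibbsProfile b w ϑ) (lambertFlow (Torus.geometry (Fin 3)) (hsDiameter σ N) p.2 p.1 t)))
      (P.prod (lambertNoise (Fin 3))) := by
    refine ((integrable_const (-Real.log (posPartition b (hsDiameter σ N) (N + 1)))).add hS).congr ?_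
    filter_upwards [hD] with p hp
    rw [Pi.add_apply]
    exact (EntropyClockDock.log_canonicalDensity_localGibbsProfile hb hϑ hw hb0 hϑ0 hσ2 N hp.2).symm
  -- the abstract ledger
  have key := klDiv_map_prod_ledger (liouville (Torus.geometry (Fin 3)) (N + 1) (hsDiameter σ N))
    (lambertNoise (Fin 3)) hΛ hinv P hPL (hm hb₀ hϑ₀ hw₀) (hm hb hϑ hw)
    (ae_canonicalDensity_localGibbsProfile_ne_zero hb₀ hϑ₀ hw₀ hb₀0 hϑ₀0 hσ2 N)
    (fun _ => ENNReal.ofReal_ne_top)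
    (ae_canonicalDensity_localGibbsProfile_ne_zero hb hϑ hw hb0 hϑ0 hσ2 N)
    (fun _ => ENNReal.ofReal_ne_top) (localGibbsLaw σ b₀ w₀ ϑ₀ N Φ) (localGibbsLaw σ b w ϑ N Φ)
    rfl rfl hkl
    (by
      refine (hI₀.sub hI).congr (Eventually.of_forall fun p => ?_)
      simp only [Pi.sub_apply, hto hb₀0 hϑ₀0, hto hb0 hϑ0])
  simpa only [hto hb₀0 hϑ₀0, hto hb0 hϑ0] using key

end Summit.AtomisticToContinuum.HydrodynamicLimit.Theorems.LambertianContactSwapLambertianEulerKlLedger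

end
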